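import Literature.NumberTheory.Automorphic.AutomorphicFormsL2WeightedTranslates
import Mathlib.MeasureTheory.Group.Integral
import HarnessLib

/-!
# Exactly invariant representatives of invariant `L²` classes by compact averaging

Topic `NumberTheory/Automorphic`; companion of `AutomorphicFormsL2WeightedTranslates` (weight `α = 1`).  Everything is PROVED;
no definition, no instance, no `sorry`.

For an adelic group datum `𝒢`, an automorphic measure `μ` on `X = G(𝔸_K) ⧸ (A_G · G(K))`, a group `S` acting on `X` through a
homomorphism `c : S → G(𝔸_K)` and a measure `ρ` on `S`, the AVERAGE `F̄(y) = ∫ F(c(s)⁻¹ • y) dρ(s)` of a function `F : X → ℂ`: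
* represents the Bochner integral `∫ R(c s) [F] dρ(s)` in `L²(μ)` (`coeFn_integral_rightRegular_toLp_eq_average`; `ρ` finite, `c`
  continuous), hence agrees with `F` a.e. when the CLASS `[F]` is `R(c s)`-invariant for all `s` and `ρ` is a probability measure
  (`average_ae_eq_of_forall_rightRegular_eq`) — a NEW REPRESENTATIVE OF THE SAME CLASS;
* is strongly measurable when `F` is (`stronglyMeasurable_average`);
* is EXACTLY invariant, at every point and with no null set, when `ρ` is left-invariant: `F̄(c(t) • y) = F̄(y)`,
  `F̄(c(t)⁻¹ • y) = F̄(y)` (`average_smul_eq`, `average_inv_smul_eq`);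
* keeps every exact invariance `F(k • y) = F(y)` under elements `k` commuting with `c(S)` (`average_smul_eq_of_commute`).
With `S` a COMPACT subgroup (Haar probability measure) this turns an `L²` class fixed by `S` into a representative fixed by `S`
EVERYWHERE — the standard first step before differentiating representatives along a commuting one-parameter family.

USE (cell hodgecm-mathlib, floor 0, P2 (D)-desk, stub (R) `StubRRegularOfReproduced`): the classes `w_j = pr_P[Φ·j]` are fixed by
the compact archimedean factor `K_c` and an open compact `K_f`; their averages are exactly `K_c K_f`-invariant representatives whose
orbital integrals along `U(2,1)` are then continuous on ALL of `G(𝔸)`.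

## References
* [Folland1995] G. B. Folland, *A Course in Abstract Harmonic Analysis* (1995), §2.2 (Haar measure, left invariance), §3.2 (the
  integrated representation `π(f)`; `π(χ_S)` for a compact subgroup averages to the fixed vectors).
* [BorelJacquetCorvallis1979] A. Borel, H. Jacquet, PSPM 33.1 (1979), §4.6.
-/

open scoped Topology ENNReal
open Set Function Filter
open _root_.MeasureTheory _root_.MeasureTheory.Measure

noncomputable section

namespace Literature.NumberTheory.Automorphic

namespace AdelicGroupData

variable {K : Type} [Field K] [NumberField K] (𝒢 : AdelicGroupData K)
  (μ : Measure 𝒢.automorphicQuotient)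

/-- **The average of the translates is a representative of the averaged class**: for `F ∈ ℒ²(μ)`, a continuous
homomorphism `c : S →* G(𝔸_K)` and a finite measure `ρ` on `S`, the Bochner integral `∫ R(c s) [F] dρ(s)` is represented by
`y ↦ ∫ F(c(s)⁻¹ • y) dρ(s)` (the weight-`1` case of `coeFn_integral_smul_rightRegular_toLp`). [cite: Folland1995, §3.2] -/
theorem coeFn_integral_rightRegular_toLp_eq_average [𝒢.IsAutomorphicMeasure μ] {S : Type*} [Group S]
    [TopologicalSpace S] [MeasurableSpace S] [BorelSpace S] [SecondCountableTopology S] (ρ : Measure S)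
    [IsFiniteMeasure ρ] {c : S →* 𝒢.Adelic} (hc : Continuous c) {F : 𝒢.automorphicQuotient → ℂ} (hF : MemLp F 2 μ) :
    ((∫ s, 𝒢.rightRegular μ (c s) (hF.toLp F) ∂ρ : 𝒢.L2 μ) : 𝒢.automorphicQuotient → ℂ) =ᵐ[μ]
      fun y ↦ ∫ s, F ((c s)⁻¹ • y) ∂ρ := by
  have h := 𝒢.coeFn_integral_smul_rightRegular_toLp μ hc ρ (integrable_const (1 : ℂ)) hF
  simp only [one_smul, one_mul] at h
  exact h

/-- **Averaging an invariant class over a probability measure does not change it**: if `R(c s) [F] = [F]` for all `s`, then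
`y ↦ ∫ F(c(s)⁻¹ • y) dρ(s)` is again a representative of `[F]`, i.e. it agrees with `F` a.e. [cite: Folland1995, §3.2] -/
theorem average_ae_eq_of_forall_rightRegular_eq [𝒢.IsAutomorphicMeasure μ] {S : Type*} [Group S]
    [TopologicalSpace S] [MeasurableSpace S] [BorelSpace S] [SecondCountableTopology S] (ρ : Measure S)
    [IsProbabilityMeasure ρ] {c : S →* 𝒢.Adelic} (hc : Continuous c) {F : 𝒢.automorphicQuotient → ℂ}
    (hF : MemLp F 2 μ) (hinv : ∀ s : S, 𝒢.rightRegular μ (c s) (hF.toLp F) = hF.toLp F) :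
    (fun y ↦ ∫ s, F ((c s)⁻¹ • y) ∂ρ) =ᵐ[μ] F := by
  have h1 := 𝒢.coeFn_integral_rightRegular_toLp_eq_average μ ρ hc hF
  have h2 : (∫ s, 𝒢.rightRegular μ (c s) (hF.toLp F) ∂ρ : 𝒢.L2 μ) = hF.toLp F := by
    simp_rw [hinv]
    rw [integral_const, probReal_univ, one_smul]
  rw [h2] at h1
  exact h1.symm.trans hF.coeFn_toLp

/-- The averaged function is strongly measurable when `F` is. [cite: Folland1995, §3.2] -/
theorem stronglyMeasurable_average {S : Type*} [TopologicalSpace S] [MeasurableSpace S] [BorelSpace S]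
    [SecondCountableTopology S] (ρ : Measure S) [SFinite ρ] {c : S → 𝒢.Adelic} (hc : Continuous c)
    {F : 𝒢.automorphicQuotient → ℂ} (hF : StronglyMeasurable F) :
    StronglyMeasurable fun y ↦ ∫ s, F ((c s)⁻¹ • y) ∂ρ := by
  have h := 𝒢.stronglyMeasurable_integral_mul_comp_param_smul hc ρ (stronglyMeasurable_const (b := (1 : ℂ))) hF
  simp only [one_mul] at h
  exact h

/-- **The average is EXACTLY invariant** under the acting group: `F̄(c(t) • y) = F̄(y)` for every `t` and EVERY `y`
(substitution `s ↦ t s`, left invariance of `ρ`; no null set). [cite: Folland1995, §2.2 and §3.2] -/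
theorem average_smul_eq {S : Type*} [Group S] [MeasurableSpace S] [MeasurableMul S] (ρ : Measure S)
    [ρ.IsMulLeftInvariant] {c : S →* 𝒢.Adelic} (F : 𝒢.automorphicQuotient → ℂ) (t : S) (y : 𝒢.automorphicQuotient) :
    (∫ s, F ((c s)⁻¹ • (c t • y)) ∂ρ) = ∫ s, F ((c s)⁻¹ • y) ∂ρ := by
  have h := integral_mul_left_eq_self (μ := ρ) (fun s ↦ F ((c s)⁻¹ • y)) t⁻¹
  rw [← h]
  congr 1 with s
  rw [map_mul, map_inv, mul_inv_rev, inv_inv, mul_smul]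

/-- The inverse form of exact invariance: `F̄(c(t)⁻¹ • y) = F̄(y)`. [cite: Folland1995, §2.2 and §3.2] -/
theorem average_inv_smul_eq {S : Type*} [Group S] [MeasurableSpace S] [MeasurableMul S] (ρ : Measure S)
    [ρ.IsMulLeftInvariant] {c : S →* 𝒢.Adelic} (F : 𝒢.automorphicQuotient → ℂ) (t : S) (y : 𝒢.automorphicQuotient) :
    (∫ s, F ((c s)⁻¹ • ((c t)⁻¹ • y)) ∂ρ) = ∫ s, F ((c s)⁻¹ • y) ∂ρ := by
  have h := 𝒢.average_smul_eq ρ F t ((c t)⁻¹ • y) (c := c)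
  rw [smul_inv_smul] at h
  exact h.symm

/-- **Averaging preserves the exact invariances already present**: if `F(k • y) = F(y)` for all `y` and `k` commutes with
every `c(s)`, then the average is again exactly `k`-invariant. [cite: Folland1995, §3.2] -/
theorem average_smul_eq_of_commute {S : Type*} [MeasurableSpace S] {ρ : Measure S} {c : S → 𝒢.Adelic}
    (F : 𝒢.automorphicQuotient → ℂ) {k : 𝒢.Adelic} (hF : ∀ y, F (k • y) = F y) (hcomm : ∀ s, Commute k (c s))
    (y : 𝒢.automorphicQuotient) :
    (∫ s, F ((c s)⁻¹ • (k • y)) ∂ρ) = ∫ s, F ((c s)⁻¹ • y) ∂ρ := by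
  congr 1 with s
  rw [← mul_smul, ← (hcomm s).inv_right.eq, mul_smul, hF]

end AdelicGroupData

end Literature.NumberTheory.Automorphic
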